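import Mathlib
import Literature.MathematicalPhysics.QuantumFieldTheory.Balaban1983to89.Setup

/-!
# `Balaban1983to89.B13FamilySum` — the family-sum bound (2.29) of T. Bałaban, *Renormalization group approach to
lattice gauge field theories. II. Cluster expansions*, Commun. Math. Phys. **116**, 1–22 (1988),
doi:10.1007/bf01239022 [Balaban1988RG2Cluster] (cell paper B13; PDF held `paper:balaban1988-cmp116-rg-ii-cluster`,
journal page = PDF page), p. 18 — a KERNEL CERTIFICATE for the located gap "(2.29) is justified only by reference"
(cell GAPS.md G-B13-04, second half).

statement-level skeleton of published theorems with citation tags; proofs where landed; nothing here is a claim about the Yang–Mills mass gap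

CITATION HEADER (lean-in-tree rule 2026-08-18).  The passage certified, p. 18 [PDF 18] ll. 12–17, verbatim from the
page render: *"Now we estimate the sum over **D** satisfying (2.2). We use the product on the right-hand side above.
For κ sufficiently large and α₆ sufficiently small we have*
  `Σ_D Π_{Y∈D} α₆ exp(−δκ d_k(Y)) ≤ 1.`   (2.29)
*Inequalities of this type were proved many times, the above can be proved, for example, by a simple modification of
the argument in [26]."*  Here ([26] = C. Cammarota, Commun. Math. Phys. **85** (1982) 517–528, entry [26] of the
reference list of [Balaban1987RG1]); (2.2) p. 12: *"Y₀ = ∪_{Y∈D} Y"*, `D ⊂ D_k` a family of (different) localization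
domains ((2.1) p. 12: *"Σ_{D⊂D_k} Π_{Y∈D} …"*), and p. 18 ll. 1–2: *"For simplicity let us denote by Y₀ one of the
components."*  So the sum in (2.29) runs over the finite families `D` of pairwise different localization domains
whose union is the fixed domain `Y₀`.  The paper prints NO proof of (2.29) (GAPS.md G-B13-04: "not printed anywhere
in the series … what would certify: a half-page proof"); the written model of the "simple modification" is
J. Dimock, *The renormalization group according to Balaban. I. Small fields*, Rev. Math. Phys. **25** (2013) 1330010
= arXiv:1108.1335, proof of Theorem 27, TeX ll. 3259–3275 (cell TEMPLATE.md §15.1 row G6): (i) extract the decay of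
the union through the tree-length inequality for overlapping families, (ii) *"Dropping all conditions on the X_i
except X_i ⊂ Y"*, (iii) the anchored entropy bound Lemma 25 (basic2) `Σ_{X∋□} exp(−κ₀ d_M(X)) ≤ K₀` per member and
the volume bound (ninety) `|Y|_M ≤ 3^d (1 + d_M(Y))` (*"Now |Y|_M ≤ 3^d(1+d_M(Y)) ≤ κ₀(1+d_M(Y)). Furthermore we
assume c₀ is small enough so that 2c₀K₀κ₀e^{κ−κ₀} ≤ 1."*).

WHAT IS REPRODUCED (unit `b2b-balaban-pv18`, surge node prover #18).  A geometry-free, sorry-free proof of (2.29)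
over an ABSTRACT finite catalogue of domains: a finite set `S` of domains `Y`, each with a finite nonempty footprint
`cubes Y` (its M-cubes) and a size `d Y ≥ 0` (its tree length d_k(Y)); the index set of (2.29) is
`coveringFamilies S cubes Y₀ = {D ⊆ S : ⋃_{Y∈D} cubes Y = Y₀}` (families of pairwise DIFFERENT domains = `Finset`s).
The two by-reference inputs of p. 8 / p. 18 enter ONLY as hypotheses, in the shape the published sources print them:
 * `Ineq126` — B13 (1.26) p. 8 [PDF 8]: *"Σ_{X∈D_j, X⊃□′} exp(−κ d_j(X)) ≤ O(1), (1.26) for κ sufficiently large. …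
   This inequality was used many times in convergence proofs for cluster expansions, for example see [48, 50, 40, 26,
   3]."* = Dimock I, Lemma 25 (basic2) (PROVED there; cell GAPS.md G-B13-04 first half, kernel work of unit
   `b2b-balaban-pv03`, module `B12TreeDecay`), with `O(1) = K₀` at rate `κ₀`;
 * `VolBound` — the volume-versus-tree-length bound `|Y| ≤ c₁ (1 + d_k(Y))` for every member domain: B13 (2.30) p. 18
   lower half *"(3·2³)⁻¹M⁻⁴|Y| ≤ d_k(Y) … holding for localization domains Y ∈ D_k"* is FALSE as printed for domains
   whose cubes share a point (GAPS.md G-B13-07, d_k = 0 there) and holds in the additive form `M⁻⁴|Y| ≤ 24(⌊d_k(Y)⌋+1)`;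
   the additive form is exactly what the published sources print — Dimock I (ninety) *"d_M(X) ≤ |X|_M ≤
   3^d(1 + d_M(X))"* (cited there to Bałaban, CMP 198), Dimock II = J. Math. Phys. **54** (2013), Lemma E.1(3)
   *"|Y|_M ≤ 4(2^d+1)(ℓ_M(Y)+1)"* (PROVED there, any finite collection of blocks).  Only the additive shape
   `|Y| ≤ c₁(1 + d Y)` with an unspecified `c₁ > 0` is assumed here.
Main results: `familySum_le_one` (route A, this unit's proof: extract one unit `a₂` of decay per member, convert
`Σ_{Y∈D}(1 + d Y) ≥ |Y₀|/c₁` (covering + `VolBound` on the members) into `exp(−(a₂/c₁)|Y₀|)`, drop the covering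
constraint — `Σ_{D ⊆ S(Y₀)} Π β = Π (1 + β) ≤ exp Σ β` — and resum the members anchored at the `|Y₀|` cubes by
`Ineq126`; NEITHER (2.27) NOR the connectedness of `Y₀` is needed, and the constants are `δκ ≥ κ₀ + a₂`,
`α₆ e^{a₂} K₀ c₁ ≤ a₂`, uniform in κ), `familySum_le_one_via227` (route B = the template's (i)–(iii) literally:
extraction through B13 (2.27) p. 18 *"Σ_{Y∈D}(d_k(Y) + 5) ≥ d_k(Y₀) + 5"* — certified by the b13 sub-cell, GAPS.md
C-B13-04, = Dimock I (clams) — and the volume bound on the UNION), the paper-lettered form `ineq229` ("κ sufficiently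
large" := `κ₀ + a₂ ≤ δκ`, "α₆ sufficiently small" := `α₆ e^{a₂} K₀ c₁ ≤ a₂`) with the unit instance `ineq229_unit`
(`κ₀ + 1 ≤ δκ`, `e K₀ c₁ α₆ ≤ 1`) for the cell's smallness census, and the edge `ineq229_locDomainSys` to the shared
carrier `LocDomainSys` (𝐃_k with `dj ≥ 0`) of `…Balaban1983to89.Setup`.
NOTHING of the series is asserted: `Ineq126`, `VolBound`, `Ineq227` are consumed only as hypotheses; the module proves
`(1.26) ∧ (2.30)-lower[additive] ⇒ (2.29)` and `(1.26) ∧ (2.27) ∧ (2.30)-lower[additive, on Y₀] ⇒ (2.29)` and nothing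
else.  `B13.lean` (units r2/b13) is untouched; its `B13.prod_bound_228` is the companion certificate (2.27) ⇒ (2.28).
Sibling engine elsewhere in the tree (not imported, heavier dependencies): `Polymer.sum_prod_le_exp_sum` of
`Literature.MathematicalPhysics.QuantumFieldTheory.PolymerCombinatorics` (the same "gas of components" step).
Staged byte-identically in the cell package `run/shared/lean/pub/pub-balaban/lean/BalabanYm4/Literature/…/B13FamilySum.lean`.
Companion prose: cell GAPS.md row C-pv18-1, `HOME/b2b-balaban-pv18/`.
v1.1 (cell `lit-balaban`, seat r10 gen 20, 2026-08-22; DOCSTRING-ONLY citeloc fix, Lean code byte-identical): v1 located the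
displays (2.1) and (2.2) one page early; both are printed on p. 12 [PDF 12] (render `…/1988-cmp116-rg-II-cluster-p012-x2.png`;
text layer `p0012.txt` L2 «(2.1)», L6 «(2.2)»; the preceding page ends with *"The first step is the Mayer expansion of the
action density"*) — three numerals corrected (module docstring ×2, `coveringFamilies` docstring + its citation tag); flagged
by the cell՚s CITELOC sweep (`lit-balaban-r12/CITELOC-SWEEP-g14.md` §11); the cell՚s verbatim framing sentence added on page 1.
-/

namespace Literature.MathematicalPhysics.QuantumFieldTheory.Balaban1983to89.B13FamilySum

open Finset

noncomputable section

variable {Dom Cube : Type*} [DecidableEq Cube]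

/-! ## Part A. The index set of (2.29) and the two quoted inputs, over an abstract catalogue -/

/-- The index set of the sum in (2.29): the families `D` of pairwise different domains from the catalogue `S` whose
union of footprints is exactly `Y₀` — (2.2) p. 12 *"Y₀ = ∪_{Y∈D} Y"*, p. 18 *"the sum over D satisfying (2.2)"*.
[cite: Balaban1988RG2Cluster, (2.2) p.12 and (2.29) p.18] -/
def coveringFamilies (S : Finset Dom) (cubes : Dom → Finset Cube) (Y₀ : Finset Cube) : Finset (Finset Dom) :=
  S.powerset.filter fun D => D.biUnion cubes = Y₀

/-- The sub-catalogue of domains lying inside `Y₀` (Dimock I, TeX l. 3263: *"Dropping all conditions on the X_i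
except X_i ⊂ Y"*). [cite: Balaban1988RG2Cluster, (2.29) p.18] -/
def inside (S : Finset Dom) (cubes : Dom → Finset Cube) (Y₀ : Finset Cube) : Finset Dom :=
  S.filter fun Y => cubes Y ⊆ Y₀

/-- B13 (1.26) p. 8, verbatim: *"Σ_{X∈D_j, X⊃□′} exp(−κ d_j(X)) ≤ O(1), (1.26) for κ sufficiently large."* — typed
over the abstract catalogue with `O(1) = K₀` at the rate `κ₀` (= Dimock I, Lemma 25 (basic2)
`Σ_{X∋□} exp(−κ₀ d_M(X)) ≤ K₀`); a HYPOTHESIS of this module (GAPS.md G-B13-04 first half).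
[cite: Balaban1988RG2Cluster, (1.26) p.8] -/
def Ineq126 (S : Finset Dom) (cubes : Dom → Finset Cube) (d : Dom → ℝ) (κ₀ K₀ : ℝ) : Prop :=
  ∀ c : Cube, ∑ Y ∈ S.filter (fun Y => c ∈ cubes Y), Real.exp (-(κ₀ * d Y)) ≤ K₀

/-- The volume-versus-tree-length bound on the member domains in its ADDITIVE form `|Y| ≤ c₁(1 + d_k(Y))` — B13
(2.30) p. 18 lower half *"(3·2³)⁻¹M⁻⁴|Y| ≤ d_k(Y)"* as repaired in GAPS.md G-B13-07 (`M⁻⁴|Y| ≤ 24(⌊d_k(Y)⌋ + 1)`),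
= Dimock I (ninety) `|X|_M ≤ 3^d(1 + d_M(X))` / Dimock II Lemma E.1(3); a HYPOTHESIS of this module.
[cite: Balaban1988RG2Cluster, (2.30) p.18] -/
def VolBound (S : Finset Dom) (cubes : Dom → Finset Cube) (d : Dom → ℝ) (c₁ : ℝ) : Prop :=
  ∀ Y ∈ S, ((cubes Y).card : ℝ) ≤ c₁ * (1 + d Y)

/-- B13 (2.27) p. 18, verbatim: *"Because ∪_{Y∈D} Y = Y₀ and Y₀ is a connected domain, hence the definition of d_k(Y)
implies the inequality Σ_{Y∈D} (d_k(Y) + 5) ≥ d_k(Y₀) + 5. (2.27)"* — typed over the abstract catalogue with the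
size `dY₀` of the union as a parameter and the printed `5` generalized to `c` (certified by the b13 sub-cell,
GAPS.md C-B13-04; = Dimock I (clams) TeX ll. 3248–3258); a HYPOTHESIS of route B only.
[cite: Balaban1988RG2Cluster, (2.27) p.18] -/
def Ineq227 (S : Finset Dom) (cubes : Dom → Finset Cube) (d : Dom → ℝ) (Y₀ : Finset Cube) (dY₀ c : ℝ) : Prop :=
  ∀ D ∈ coveringFamilies S cubes Y₀, dY₀ + c ≤ ∑ Y ∈ D, (d Y + c)

/-- (2.29) p. 18, verbatim: *"For κ sufficiently large and α₆ sufficiently small we have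
Σ_D Π_{Y∈D} α₆ exp(−δκ d_k(Y)) ≤ 1. (2.29)"*, the sum over the families `D` of different localization domains with
`∪_{Y∈D} Y = Y₀` — typed over the abstract catalogue at the rate `r` (print: `r = δκ`), for every `Y₀`.
[cite: Balaban1988RG2Cluster, (2.29) p.18] -/
def Ineq229 (S : Finset Dom) (cubes : Dom → Finset Cube) (d : Dom → ℝ) (α₆ r : ℝ) : Prop :=
  ∀ Y₀ : Finset Cube, ∑ D ∈ coveringFamilies S cubes Y₀, ∏ Y ∈ D, α₆ * Real.exp (-(r * d Y)) ≤ 1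

/-- Membership in the index set of (2.29): a subfamily of the catalogue whose footprints cover exactly `Y₀`. [folklore] -/
theorem mem_coveringFamilies {S : Finset Dom} {cubes : Dom → Finset Cube} {Y₀ : Finset Cube} {D : Finset Dom} :
    D ∈ coveringFamilies S cubes Y₀ ↔ D ⊆ S ∧ D.biUnion cubes = Y₀ := by
  simp [coveringFamilies]

/-- Membership in the inside-catalogue. [folklore] -/
theorem mem_inside {S : Finset Dom} {cubes : Dom → Finset Cube} {Y₀ : Finset Cube} {Y : Dom} :
    Y ∈ inside S cubes Y₀ ↔ Y ∈ S ∧ cubes Y ⊆ Y₀ := by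
  simp [inside]

/-- Every member of a covering family lies inside the union. [folklore] -/
theorem subset_inside_of_mem {S : Finset Dom} {cubes : Dom → Finset Cube} {Y₀ : Finset Cube} {D : Finset Dom}
    (hD : D ∈ coveringFamilies S cubes Y₀) : D ⊆ inside S cubes Y₀ := by
  obtain ⟨hDS, hU⟩ := mem_coveringFamilies.mp hD
  intro Y hY
  refine mem_inside.mpr ⟨hDS hY, ?_⟩
  rw [← hU]
  exact Finset.subset_biUnion_of_mem cubes hY

/-! ## Part B. The engine: drop the covering constraint, `Π (1 + β) ≤ exp Σ β`, anchored resummation -/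

/-- Step (ii) *"Dropping all conditions … except X_i ⊂ Y"*: for nonnegative weights the sum over covering families
is at most the sum over ALL subfamilies of the inside-catalogue, i.e. `Π_{Y ⊂ Y₀} (1 + β(Y))`.
[cite: Balaban1988RG2Cluster, (2.29) p.18] -/
theorem sum_coveringFamilies_le_prod_one_add (S : Finset Dom) (cubes : Dom → Finset Cube) (Y₀ : Finset Cube)
    (β : Dom → ℝ) (hβ : ∀ Y ∈ S, 0 ≤ β Y) :
    ∑ D ∈ coveringFamilies S cubes Y₀, ∏ Y ∈ D, β Y ≤ ∏ Y ∈ inside S cubes Y₀, (1 + β Y) := by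
  rw [Finset.prod_one_add]
  refine Finset.sum_le_sum_of_subset_of_nonneg ?_ ?_
  · intro D hD
    exact Finset.mem_powerset.mpr (subset_inside_of_mem hD)
  · intro D hD _
    exact Finset.prod_nonneg fun Y hY => hβ Y (mem_inside.mp (Finset.mem_powerset.mp hD hY)).1

/-- `Π (1 + β) ≤ exp (Σ β)` for `β ≥ 0`. [folklore] -/
theorem prod_one_add_le_exp_sum (T : Finset Dom) (β : Dom → ℝ) (hβ : ∀ Y ∈ T, 0 ≤ β Y) :
    ∏ Y ∈ T, (1 + β Y) ≤ Real.exp (∑ Y ∈ T, β Y) := by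
  rw [Real.exp_sum]
  exact Finset.prod_le_prod (fun Y hY => by linarith [hβ Y hY]) fun Y _ => by
    linarith [Real.add_one_le_exp (β Y)]

/-- Step (iii), anchored resummation: if every domain of the catalogue has a nonempty footprint and the anchored
sums `Σ_{Y ∋ □} β(Y)` are `≤ B` for the cubes `□` of `Y₀`, then `Σ_{Y ⊂ Y₀} β(Y) ≤ |Y₀| · B`.
[cite: Balaban1988RG2Cluster, (2.29) p.18] -/
theorem sum_inside_le_card_mul (S : Finset Dom) (cubes : Dom → Finset Cube) (Y₀ : Finset Cube) (β : Dom → ℝ)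
    (B : ℝ) (hβ : ∀ Y ∈ S, 0 ≤ β Y) (hne : ∀ Y ∈ S, (cubes Y).Nonempty)
    (hanch : ∀ c ∈ Y₀, ∑ Y ∈ S.filter (fun Y => c ∈ cubes Y), β Y ≤ B) :
    ∑ Y ∈ inside S cubes Y₀, β Y ≤ (Y₀.card : ℝ) * B := by
  classical
  set g : Dom → Cube → ℝ := fun Y c => if c ∈ cubes Y then β Y else 0 with hg
  have h1 : ∑ Y ∈ inside S cubes Y₀, β Y ≤ ∑ Y ∈ inside S cubes Y₀, ∑ c ∈ Y₀, g Y c := by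
    refine Finset.sum_le_sum fun Y hY => ?_
    obtain ⟨hYS, hsub⟩ := mem_inside.mp hY
    obtain ⟨c₀, hc₀⟩ := hne Y hYS
    have hg0 : ∀ c ∈ Y₀, 0 ≤ g Y c := fun c _ => by
      simp only [hg]; split_ifs
      · exact hβ Y hYS
      · exact le_rfl
    calc β Y = g Y c₀ := by simp [hg, hc₀]
      _ ≤ ∑ c ∈ Y₀, g Y c := Finset.single_le_sum hg0 (hsub hc₀)
  have h3 : ∀ c ∈ Y₀, ∑ Y ∈ inside S cubes Y₀, g Y c ≤ B := by
    intro c hc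
    calc ∑ Y ∈ inside S cubes Y₀, g Y c
        = ∑ Y ∈ (inside S cubes Y₀).filter (fun Y => c ∈ cubes Y), β Y := by
          rw [Finset.sum_filter]
      _ ≤ ∑ Y ∈ S.filter (fun Y => c ∈ cubes Y), β Y := by
          refine Finset.sum_le_sum_of_subset_of_nonneg ?_ ?_
          · intro Y hY
            rw [Finset.mem_filter] at hY ⊢
            exact ⟨(mem_inside.mp hY.1).1, hY.2⟩
          · intro Y hY _
            exact hβ Y (Finset.mem_filter.mp hY).1
      _ ≤ B := hanch c hc
  calc ∑ Y ∈ inside S cubes Y₀, β Y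
      ≤ ∑ Y ∈ inside S cubes Y₀, ∑ c ∈ Y₀, g Y c := h1
    _ = ∑ c ∈ Y₀, ∑ Y ∈ inside S cubes Y₀, g Y c := Finset.sum_comm
    _ ≤ ∑ c ∈ Y₀, B := Finset.sum_le_sum h3
    _ = (Y₀.card : ℝ) * B := by rw [Finset.sum_const, nsmul_eq_mul]

/-- Steps (ii) + (iii) assembled: `Σ_{D covering Y₀} Π_{Y∈D} β(Y) ≤ exp(|Y₀| · B)`.
[cite: Balaban1988RG2Cluster, (2.29) p.18] -/
theorem sum_coveringFamilies_le_exp (S : Finset Dom) (cubes : Dom → Finset Cube) (Y₀ : Finset Cube)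
    (β : Dom → ℝ) (B : ℝ) (hβ : ∀ Y ∈ S, 0 ≤ β Y) (hne : ∀ Y ∈ S, (cubes Y).Nonempty)
    (hanch : ∀ c ∈ Y₀, ∑ Y ∈ S.filter (fun Y => c ∈ cubes Y), β Y ≤ B) :
    ∑ D ∈ coveringFamilies S cubes Y₀, ∏ Y ∈ D, β Y ≤ Real.exp ((Y₀.card : ℝ) * B) :=
  calc ∑ D ∈ coveringFamilies S cubes Y₀, ∏ Y ∈ D, β Y
      ≤ ∏ Y ∈ inside S cubes Y₀, (1 + β Y) := sum_coveringFamilies_le_prod_one_add S cubes Y₀ β hβ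
    _ ≤ Real.exp (∑ Y ∈ inside S cubes Y₀, β Y) :=
        prod_one_add_le_exp_sum _ β fun Y hY => hβ Y (mem_inside.mp hY).1
    _ ≤ Real.exp ((Y₀.card : ℝ) * B) :=
        Real.exp_le_exp.mpr (sum_inside_le_card_mul S cubes Y₀ β B hβ hne hanch)

/-- Covering forces total member volume `≥ |Y₀|`; with `VolBound` on the members, `|Y₀| ≤ c₁ Σ_{Y∈D} (1 + d Y)`.
[cite: Balaban1988RG2Cluster, (2.29)–(2.30) p.18] -/
theorem card_le_of_covering {S : Finset Dom} {cubes : Dom → Finset Cube} {Y₀ : Finset Cube} {D : Finset Dom}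
    (hD : D ∈ coveringFamilies S cubes Y₀) (d : Dom → ℝ) (c₁ : ℝ) (hvol : VolBound S cubes d c₁) :
    (Y₀.card : ℝ) ≤ c₁ * ∑ Y ∈ D, (1 + d Y) := by
  obtain ⟨hDS, hU⟩ := mem_coveringFamilies.mp hD
  calc (Y₀.card : ℝ) = ((D.biUnion cubes).card : ℝ) := by rw [hU]
    _ ≤ ((∑ Y ∈ D, (cubes Y).card : ℕ) : ℝ) := by exact_mod_cast Finset.card_biUnion_le
    _ = ∑ Y ∈ D, ((cubes Y).card : ℝ) := by push_cast; rfl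
    _ ≤ ∑ Y ∈ D, c₁ * (1 + d Y) := Finset.sum_le_sum fun Y hY => hvol Y (hDS hY)
    _ = c₁ * ∑ Y ∈ D, (1 + d Y) := by rw [Finset.mul_sum]

/-! ## Part C. Route A: (1.26) on the members + the additive volume bound on the members ⇒ (2.29) -/

/-- **(2.29), route A.**  Over a finite catalogue `S` of domains with nonempty footprints, sizes `d`, the additive
volume bound `|Y| ≤ c₁(1 + d Y)` on the members and the anchored entropy bound (1.26) at rate `a₁` with constant
`K₀`: if `α e^{a₂} K₀ c₁ ≤ a₂` then for EVERY finite `Y₀` (connected or not)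
`Σ_{D : ⋃ D = Y₀} Π_{Y∈D} α exp(−(a₁ + a₂) d Y) ≤ 1`.  Proof: per member `α e^{−(a₁+a₂)d} = e^{−a₂(1+d)} · β` with
`β = α e^{a₂} e^{−a₁ d}`; covering + volume bound give `Π e^{−a₂(1+d)} ≤ e^{−(a₂/c₁)|Y₀|}`; steps (ii)+(iii) give
`Σ_D Π β ≤ exp(|Y₀| α e^{a₂} K₀)`; the exponents cancel under the smallness condition.  Neither (2.27) nor the
connectedness of `Y₀` is used. [cite: Balaban1988RG2Cluster, (2.29) p.18] -/
theorem familySum_le_one (S : Finset Dom) (cubes : Dom → Finset Cube) (d : Dom → ℝ) (Y₀ : Finset Cube)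
    (a₁ a₂ α K₀ c₁ : ℝ) (hα : 0 ≤ α) (ha₂ : 0 ≤ a₂) (hc₁ : 0 < c₁)
    (hne : ∀ Y ∈ S, (cubes Y).Nonempty) (hvol : VolBound S cubes d c₁)
    (hent : ∀ c ∈ Y₀, ∑ Y ∈ S.filter (fun Y => c ∈ cubes Y), Real.exp (-(a₁ * d Y)) ≤ K₀)
    (hsmall : α * Real.exp a₂ * K₀ * c₁ ≤ a₂) :
    ∑ D ∈ coveringFamilies S cubes Y₀, ∏ Y ∈ D, α * Real.exp (-((a₁ + a₂) * d Y)) ≤ 1 := by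
  classical
  set β : Dom → ℝ := fun Y => α * Real.exp a₂ * Real.exp (-(a₁ * d Y)) with hβdef
  have hβ : ∀ Y ∈ S, 0 ≤ β Y := fun Y _ => by positivity
  have hfac : ∀ Y, α * Real.exp (-((a₁ + a₂) * d Y)) = Real.exp (-(a₂ * (1 + d Y))) * β Y := by
    intro Y
    have : -((a₁ + a₂) * d Y) = -(a₂ * (1 + d Y)) + (a₂ + -(a₁ * d Y)) := by ring
    rw [hβdef, this, Real.exp_add, Real.exp_add]; ring
  -- termwise extraction of `exp(−(a₂/c₁)|Y₀|)`
  have hterm : ∀ D ∈ coveringFamilies S cubes Y₀,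
      ∏ Y ∈ D, α * Real.exp (-((a₁ + a₂) * d Y)) ≤ Real.exp (-(a₂ / c₁ * Y₀.card)) * ∏ Y ∈ D, β Y := by
    intro D hD
    have hDS := (mem_coveringFamilies.mp hD).1
    simp_rw [hfac]
    rw [Finset.prod_mul_distrib, ← Real.exp_sum]
    refine mul_le_mul_of_nonneg_right ?_ (Finset.prod_nonneg fun Y hY => hβ Y (hDS hY))
    refine Real.exp_le_exp.mpr ?_
    have hcov := card_le_of_covering hD d c₁ hvol
    have hsum : ∑ Y ∈ D, -(a₂ * (1 + d Y)) = -(a₂ * ∑ Y ∈ D, (1 + d Y)) := by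
      rw [Finset.mul_sum, ← Finset.sum_neg_distrib]
    rw [hsum]
    have h1 : a₂ / c₁ * (Y₀.card : ℝ) ≤ a₂ / c₁ * (c₁ * ∑ Y ∈ D, (1 + d Y)) :=
      mul_le_mul_of_nonneg_left hcov (div_nonneg ha₂ hc₁.le)
    have h2 : a₂ / c₁ * (c₁ * ∑ Y ∈ D, (1 + d Y)) = a₂ * ∑ Y ∈ D, (1 + d Y) := by
      field_simp
    linarith
  have hanch : ∀ c ∈ Y₀, ∑ Y ∈ S.filter (fun Y => c ∈ cubes Y), β Y ≤ α * Real.exp a₂ * K₀ := by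
    intro c hc
    rw [hβdef, ← Finset.mul_sum]
    exact mul_le_mul_of_nonneg_left (hent c hc) (by positivity)
  have hK : α * Real.exp a₂ * K₀ ≤ a₂ / c₁ := by
    rw [le_div_iff₀ hc₁]; exact hsmall
  calc ∑ D ∈ coveringFamilies S cubes Y₀, ∏ Y ∈ D, α * Real.exp (-((a₁ + a₂) * d Y))
      ≤ ∑ D ∈ coveringFamilies S cubes Y₀, Real.exp (-(a₂ / c₁ * Y₀.card)) * ∏ Y ∈ D, β Y :=
        Finset.sum_le_sum hterm
    _ = Real.exp (-(a₂ / c₁ * Y₀.card)) * ∑ D ∈ coveringFamilies S cubes Y₀, ∏ Y ∈ D, β Y := by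
        rw [Finset.mul_sum]
    _ ≤ Real.exp (-(a₂ / c₁ * Y₀.card)) * Real.exp ((Y₀.card : ℝ) * (α * Real.exp a₂ * K₀)) :=
        mul_le_mul_of_nonneg_left
          (sum_coveringFamilies_le_exp S cubes Y₀ β _ hβ hne hanch) (Real.exp_pos _).le
    _ = Real.exp ((Y₀.card : ℝ) * (α * Real.exp a₂ * K₀ - a₂ / c₁)) := by
        rw [← Real.exp_add]; ring_nf
    _ ≤ 1 := by
        refine Real.exp_le_one_iff.mpr (mul_nonpos_iff.mpr (Or.inl ⟨Nat.cast_nonneg _, ?_⟩))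
        linarith

/-! ## Part D. Route B — the template's three moves literally: (2.27) + (1.26) + the volume bound on the union -/

/-- **(2.29), route B** (Dimock I, TeX ll. 3259–3275, moves (i)–(iii)): with (2.27) in the form
`dY₀ + c ≤ Σ_{Y∈D}(d Y + c)` (`c ≥ 1`; print `c = 5`), the additive volume bound `|Y₀| ≤ c₁(1 + dY₀)` on the UNION,
(1.26) at rate `a₁` with constant `K₀ ≥ 0`, and `α e^{c a₂} K₀ c₁ ≤ a₂`:
`Σ_{D : ⋃ D = Y₀} Π_{Y∈D} α exp(−(a₁ + a₂) d Y) ≤ 1`.  (Extraction (i): `Π e^{−a₂ d} ≤ e^{−a₂(dY₀ + c)} e^{c a₂ |D|}`;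
(ii)+(iii): `≤ exp(|Y₀| α e^{c a₂} K₀) ≤ exp(a₂ (1 + dY₀))`.) [cite: Balaban1988RG2Cluster, (2.27)–(2.29) p.18] -/
theorem familySum_le_one_via227 (S : Finset Dom) (cubes : Dom → Finset Cube) (d : Dom → ℝ) (Y₀ : Finset Cube)
    (a₁ a₂ α K₀ c₁ c dY₀ : ℝ) (hα : 0 ≤ α) (ha₂ : 0 ≤ a₂) (hK₀ : 0 ≤ K₀) (hc : 1 ≤ c)
    (hdY₀ : 0 ≤ dY₀) (hne : ∀ Y ∈ S, (cubes Y).Nonempty)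
    (h227 : Ineq227 S cubes d Y₀ dY₀ c) (hvol₀ : (Y₀.card : ℝ) ≤ c₁ * (1 + dY₀))
    (hent : ∀ c' ∈ Y₀, ∑ Y ∈ S.filter (fun Y => c' ∈ cubes Y), Real.exp (-(a₁ * d Y)) ≤ K₀)
    (hsmall : α * Real.exp (c * a₂) * K₀ * c₁ ≤ a₂) :
    ∑ D ∈ coveringFamilies S cubes Y₀, ∏ Y ∈ D, α * Real.exp (-((a₁ + a₂) * d Y)) ≤ 1 := by
  classical
  set β : Dom → ℝ := fun Y => α * Real.exp (c * a₂) * Real.exp (-(a₁ * d Y)) with hβdef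
  have hβ : ∀ Y ∈ S, 0 ≤ β Y := fun Y _ => by positivity
  have hfac : ∀ Y, α * Real.exp (-((a₁ + a₂) * d Y)) = Real.exp (-(a₂ * (d Y + c))) * β Y := by
    intro Y
    have : -((a₁ + a₂) * d Y) = -(a₂ * (d Y + c)) + (c * a₂ + -(a₁ * d Y)) := by ring
    rw [hβdef, this, Real.exp_add, Real.exp_add]; ring
  have hterm : ∀ D ∈ coveringFamilies S cubes Y₀,
      ∏ Y ∈ D, α * Real.exp (-((a₁ + a₂) * d Y)) ≤ Real.exp (-(a₂ * (dY₀ + c))) * ∏ Y ∈ D, β Y := by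
    intro D hD
    have hDS := (mem_coveringFamilies.mp hD).1
    simp_rw [hfac]
    rw [Finset.prod_mul_distrib, ← Real.exp_sum]
    refine mul_le_mul_of_nonneg_right ?_ (Finset.prod_nonneg fun Y hY => hβ Y (hDS hY))
    refine Real.exp_le_exp.mpr ?_
    have hsum : ∑ Y ∈ D, -(a₂ * (d Y + c)) = -(a₂ * ∑ Y ∈ D, (d Y + c)) := by
      rw [Finset.mul_sum, ← Finset.sum_neg_distrib]
    rw [hsum]
    have := mul_le_mul_of_nonneg_left (h227 D hD) ha₂
    linarith
  have hanch : ∀ c' ∈ Y₀, ∑ Y ∈ S.filter (fun Y => c' ∈ cubes Y), β Y ≤ α * Real.exp (c * a₂) * K₀ := by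
    intro c' hc'
    rw [hβdef, ← Finset.mul_sum]
    exact mul_le_mul_of_nonneg_left (hent c' hc') (by positivity)
  have hB : 0 ≤ α * Real.exp (c * a₂) * K₀ := by positivity
  calc ∑ D ∈ coveringFamilies S cubes Y₀, ∏ Y ∈ D, α * Real.exp (-((a₁ + a₂) * d Y))
      ≤ ∑ D ∈ coveringFamilies S cubes Y₀, Real.exp (-(a₂ * (dY₀ + c))) * ∏ Y ∈ D, β Y :=
        Finset.sum_le_sum hterm
    _ = Real.exp (-(a₂ * (dY₀ + c))) * ∑ D ∈ coveringFamilies S cubes Y₀, ∏ Y ∈ D, β Y := by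
        rw [Finset.mul_sum]
    _ ≤ Real.exp (-(a₂ * (dY₀ + c))) * Real.exp ((Y₀.card : ℝ) * (α * Real.exp (c * a₂) * K₀)) :=
        mul_le_mul_of_nonneg_left
          (sum_coveringFamilies_le_exp S cubes Y₀ β _ hβ hne hanch) (Real.exp_pos _).le
    _ ≤ Real.exp (-(a₂ * (dY₀ + c))) * Real.exp (c₁ * (1 + dY₀) * (α * Real.exp (c * a₂) * K₀)) :=
        mul_le_mul_of_nonneg_left (Real.exp_le_exp.mpr (mul_le_mul_of_nonneg_right hvol₀ hB))
          (Real.exp_pos _).le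
    _ = Real.exp (-(a₂ * (dY₀ + c)) + c₁ * (1 + dY₀) * (α * Real.exp (c * a₂) * K₀)) := by
        rw [← Real.exp_add]
    _ ≤ 1 := by
        refine Real.exp_le_one_iff.mpr ?_
        have h1 : c₁ * (1 + dY₀) * (α * Real.exp (c * a₂) * K₀) = (1 + dY₀) * (α * Real.exp (c * a₂) * K₀ * c₁) := by
          ring
        have h2 : (1 + dY₀) * (α * Real.exp (c * a₂) * K₀ * c₁) ≤ (1 + dY₀) * a₂ :=
          mul_le_mul_of_nonneg_left hsmall (by linarith)
        nlinarith

/-! ## Part E. The paper's letters: "κ sufficiently large and α₆ sufficiently small" made explicit -/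

/-- Monotonicity of the (2.29) summands in the rate: for `d ≥ 0`, `α ≥ 0` and `r ≤ r'`, the sum at rate `r'` is at most
the sum at rate `r`. [cite: Balaban1988RG2Cluster, (2.29) p.18] -/
theorem sum_coveringFamilies_mono_rate (S : Finset Dom) (cubes : Dom → Finset Cube) (d : Dom → ℝ)
    (Y₀ : Finset Cube) (α r r' : ℝ) (hα : 0 ≤ α) (hd : ∀ Y ∈ S, 0 ≤ d Y) (hrr : r ≤ r') :
    ∑ D ∈ coveringFamilies S cubes Y₀, ∏ Y ∈ D, α * Real.exp (-(r' * d Y))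
      ≤ ∑ D ∈ coveringFamilies S cubes Y₀, ∏ Y ∈ D, α * Real.exp (-(r * d Y)) := by
  refine Finset.sum_le_sum fun D hD => ?_
  have hDS := (mem_coveringFamilies.mp hD).1
  refine Finset.prod_le_prod (fun Y _ => by positivity) fun Y hY => ?_
  refine mul_le_mul_of_nonneg_left (Real.exp_le_exp.mpr ?_) hα
  have := mul_le_mul_of_nonneg_right hrr (hd Y (hDS hY))
  linarith

/-- **(2.29) in the paper's letters.**  For a catalogue of domains with nonempty footprints and sizes `d ≥ 0`
satisfying (1.26) at rate `κ₀` with constant `K₀` and the additive volume bound with constant `c₁ > 0`: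
"κ sufficiently large" := `κ₀ + a₂ ≤ δκ` and "α₆ sufficiently small" := `α₆ e^{a₂} K₀ c₁ ≤ a₂` (any `a₂ ≥ 0`) give
`Σ_D Π_{Y∈D} α₆ exp(−δκ d_k(Y)) ≤ 1` for every `Y₀`, i.e. `Ineq229 S cubes d α₆ (δκ)`.
[cite: Balaban1988RG2Cluster, (2.29) p.18] -/
theorem ineq229 (S : Finset Dom) (cubes : Dom → Finset Cube) (d : Dom → ℝ) (κ₀ K₀ c₁ δ κ α₆ a₂ : ℝ)
    (hd : ∀ Y ∈ S, 0 ≤ d Y) (hne : ∀ Y ∈ S, (cubes Y).Nonempty) (hvol : VolBound S cubes d c₁)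
    (h126 : Ineq126 S cubes d κ₀ K₀) (hα₆ : 0 ≤ α₆) (ha₂ : 0 ≤ a₂) (hc₁ : 0 < c₁)
    (hκ : κ₀ + a₂ ≤ δ * κ) (hsmall : α₆ * Real.exp a₂ * K₀ * c₁ ≤ a₂) :
    Ineq229 S cubes d α₆ (δ * κ) := by
  intro Y₀
  calc ∑ D ∈ coveringFamilies S cubes Y₀, ∏ Y ∈ D, α₆ * Real.exp (-(δ * κ * d Y))
      ≤ ∑ D ∈ coveringFamilies S cubes Y₀, ∏ Y ∈ D, α₆ * Real.exp (-((κ₀ + a₂) * d Y)) :=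
        sum_coveringFamilies_mono_rate S cubes d Y₀ α₆ (κ₀ + a₂) (δ * κ) hα₆ hd hκ
    _ ≤ 1 := familySum_le_one S cubes d Y₀ κ₀ a₂ α₆ K₀ c₁ hα₆ ha₂ hc₁ hne hvol (fun c _ => h126 c) hsmall

/-- The unit instance for the cell's smallness census (`a₂ = 1`): `κ₀ + 1 ≤ δκ` and `e K₀ c₁ α₆ ≤ 1` suffice for
(2.29) — α₆ = α₆(κ₀, K₀, c₁) INDEPENDENT of κ, consistent with the printed order of choice ("κ sufficiently large
and α₆ sufficiently small", then restriction R15 `2E₀ε₁C₁α₄⁻¹α₆⁻¹M^q exp C₂κ₁ exp 5κ ≤ 1` on ε₁).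
[cite: Balaban1988RG2Cluster, (2.29) p.18] -/
theorem ineq229_unit (S : Finset Dom) (cubes : Dom → Finset Cube) (d : Dom → ℝ) (κ₀ K₀ c₁ δ κ α₆ : ℝ)
    (hd : ∀ Y ∈ S, 0 ≤ d Y) (hne : ∀ Y ∈ S, (cubes Y).Nonempty) (hvol : VolBound S cubes d c₁)
    (h126 : Ineq126 S cubes d κ₀ K₀) (hα₆ : 0 ≤ α₆) (hc₁ : 0 < c₁)
    (hκ : κ₀ + 1 ≤ δ * κ) (hsmall : Real.exp 1 * K₀ * c₁ * α₆ ≤ 1) :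
    Ineq229 S cubes d α₆ (δ * κ) :=
  ineq229 S cubes d κ₀ K₀ c₁ δ κ α₆ 1 hd hne hvol h126 hα₆ zero_le_one hc₁ hκ (by linarith)

/-! ## Part F. Edge to the shared carrier `LocDomainSys` of module `Setup` (the localization domains 𝐃_k with d_k ≥ 0) -/

/-- (2.29) over the cell's shared carrier of localization domains `LocDomainSys` of `…Balaban1983to89.Setup` (`Dom`
finite, `dj ≥ 0`),
given the cube footprints of the domains: (1.26) at rate `κ₀` with `K₀`, the additive volume bound with `c₁ > 0`,
`κ₀ + a₂ ≤ δκ` and `α₆ e^{a₂} K₀ c₁ ≤ a₂` give (2.29) for the whole catalogue `𝐃_k = Finset.univ` and every `Y₀`.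
[cite: Balaban1988RG2Cluster, (2.29) p.18] -/
theorem ineq229_locDomainSys (D : LocDomainSys) (cubes : D.Dom → Finset Cube)
    (κ₀ K₀ c₁ δ κ α₆ a₂ : ℝ) (hne : ∀ Y, (cubes Y).Nonempty)
    (hvol : VolBound (Finset.univ : Finset D.Dom) cubes D.dj c₁)
    (h126 : Ineq126 (Finset.univ : Finset D.Dom) cubes D.dj κ₀ K₀) (hα₆ : 0 ≤ α₆) (ha₂ : 0 ≤ a₂) (hc₁ : 0 < c₁)
    (hκ : κ₀ + a₂ ≤ δ * κ) (hsmall : α₆ * Real.exp a₂ * K₀ * c₁ ≤ a₂) :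
    Ineq229 (Finset.univ : Finset D.Dom) cubes D.dj α₆ (δ * κ) :=
  ineq229 Finset.univ cubes D.dj κ₀ K₀ c₁ δ κ α₆ a₂ (fun Y _ => D.dj_nonneg Y) (fun Y _ => hne Y) hvol h126 hα₆ ha₂
    hc₁ hκ hsmall

end

end Literature.MathematicalPhysics.QuantumFieldTheory.Balaban1983to89.B13FamilySum
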